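import Mathlib.Analysis.InnerProductSpace.Calculus
import Mathlib.Analysis.Calculus.DifferentialForm.Basic
import Mathlib.Analysis.Calculus.Deriv.Inv
import Mathlib.Analysis.Normed.Module.Alternating.Basic
import Literature.Geometry.Kaehler.ManifoldFormsPullback
import Literature.Geometry.Kaehler.PluriharmonicLog
import Literature.NumberTheory.Transcendental.ComplexFormsPullback
import HarnessLib

/-!
# The Fubini–Study form and its pull-back along holomorphic maps

Layer `Literature/Geometry/Kaehler`. Support for the proof that smooth projective varieties are
Kähler (`Literature/AlgebraicGeometry/Motives/GAGAKaehlerProofs`, discharging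
`Literature.AlgebraicGeometry.Motives.isKaehlerManifold_of_isAnalytification_of_isClosedImmersion`).
Everything in this file is PROVED; there are no named facts.

## Part 1. The Fubini–Study `2`-form on a complex inner product space, off the origin

The real calculus of the Fubini–Study form on `W ∖ {0}`, `W` a complex inner product space, in
the normalisation

  `β₀ = d α₀`,  `α₀(Z)(a) = Im ⟪Z, a⟫ / ‖Z‖²`

(so that `β₀ = 2 Im h_FS` with `h_FS(Z)(a, b) = (⟪a, b⟫ ‖Z‖² - ⟪a, Z⟫⟪Z, b⟫) / ‖Z‖⁴` the
Fubini–Study Hermitian form lifted to `W ∖ {0}`; Voisin (2002), §3.3.2, proof of Lemma 3.16: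
`∂̄ log (1/(1+|z|²)) = -(Σ zᵢ dz̄ᵢ)/(1+|z|²)` and the displayed formula for `ωᵢ`). Defining `β₀` as an
exterior derivative makes it closed for free (`d ∘ d = 0`, Mathlib `extDeriv_extDeriv_apply`);
its value is computed once (`fubiniStudyForm_apply`):

* `fubiniStudyPotential`, `fubiniStudyForm` (`α₀`, `β₀ = extDeriv α₀`), `C^∞` off `0`;
* `fubiniStudyForm_apply` (the explicit formula), `extDeriv_fubiniStudyForm` (`dβ₀ = 0` off `0`);
* `fubiniStudyForm_I_smul` (`β₀` is `J`-invariant: a real `(1,1)`-form),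
  `fubiniStudyForm_self_I_smul` / `_nonneg` / `exists_eq_smul_of_…_eq_zero` (positivity:
  `β₀(Z)(a, ia) = 2(‖Z‖²‖a‖² - |⟪Z,a⟫|²)/‖Z‖⁴ ≥ 0`, `= 0` iff `a ∈ ℂ Z`, Cauchy–Schwarz);
* `fubiniStudyForm_smul_add_smul` (projective invariance:
  `β₀(cZ)(ca + μZ, cb + νZ) = β₀(Z)(a, b)` for `c ≠ 0`), i.e. `β₀` descends to `ℙ(W)` and its
  pull-back along a holomorphic lift does not depend on the lift.

## Part 2. The pull-back along a holomorphic map into `W ∖ {0}`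

For a complex manifold `M` (charts in the finite-dimensional complex space `E`, holomorphic
transition maps, regarded as a real `C^∞` manifold with the same charts) and a map `G : M → W`
(`W` finite-dimensional), holomorphic on an open set `U` and non-vanishing there, the `2`-form

  `θ_G := G^* β₀`  (`Literature.Geometry.Kaehler.fsPullback E G`)

is the Kähler form of the metric induced on `U` by the Fubini–Study metric of `ℙ(W)` through the
holomorphic map `[G] : U → ℙ(W)` (Voisin (2002), §3.1.3: "the corresponding Kähler form `ω_N` is
equal to `j^* ω_M`"; §3.3.2). Pointwise on `U` (so that it applies to maps holomorphic only on an
open set):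

* `fsPullback_apply` — `θ_G(m)(v, w) = β₀(G m)(dG_m v, dG_m w)`; `fsPullback_congr_of_eventuallyEq`
  (`θ_G(m)` depends only on the germ of `G`);
* `smoothAt_fsPullback`, `mextDeriv_fsPullback` — `θ_G` is smooth and closed at the points of `U`
  (pull-back calculus of `ManifoldFormsPullback`, `d ∘ d = 0`);
* `fsPullback_tangentJ` — `θ_G` is `J`-invariant (`dG` is `ℂ`-linear);
* `fsPullback_self_tangentJ_nonneg`, `exists_mfderiv_eq_smul_of_fsPullback_eq_zero` —
  `θ_G(v, Jv) ≥ 0`, with equality only if `dG_m v ∈ ℂ · G(m)`;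
* `fsPullback_smul` — `θ_{fG}(m) = θ_G(m)` for `f` holomorphic with `f m ≠ 0` (projective
  invariance: the form only depends on `[G] : U → ℙ(W)`; Voisin (2002), §3.3.1, the local Chern
  forms "coincide on `Uᵢ ∩ Uⱼ`").

## Part 3. A closed positive real `(1,1)`-form is a Kähler form

`isKaehlerManifold_of_closed_positive_form`: on a complex manifold `M` (finite-dimensional model
`E`), a smooth closed real `2`-form `θ` with `θ(Jv, Jw) = θ(v, w)` and `θ(v, Jv) > 0` for `v ≠ 0`
is the Kähler form of the smooth Hermitian metric `g(v, w) = θ(v, Jw)` (Voisin (2002), §3.1.1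
Lemma 3.3, §3.1.2 Def. 3.6), so that `Literature.Geometry.Kaehler.IsKaehlerManifold E M` holds.
The smoothness of `g` as a section of Mathlib's bundle of bilinear forms is the converse of the
computation `Bundle.ContMDiffRiemannianMetric.isSmoothForm_kaehlerForm_toRiemannianMetric` of
`KaehlerProofs` (same trivialization calculus); coercivity `c‖v‖² ≤ g(v,v)` in finite dimension
(`exists_pos_mul_norm_sq_le`) gives the von Neumann boundedness required by Mathlib's
`Bundle.RiemannianMetric`.

## References

* C. Voisin, *Hodge Theory and Complex Algebraic Geometry I* (CUP 2002), §3.1.1 (Lemma 3.3: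
  `ω = -Im h`, `g = Re h`), §3.1.3 (submanifolds of Kähler manifolds), §3.3.1–§3.3.2 (Chern forms,
  Fubini–Study metric, Lemma 3.16 and the corollary p. 77: "every complex projective manifold
  (i.e. complex submanifold of projective space) is Kähler").
* P. Griffiths, J. Harris, *Principles of Algebraic Geometry* (1978), pp. 30–31, 109.
-/

noncomputable section

open scoped ComplexConjugate InnerProductSpace ContDiff Topology Manifold
open Complex ContinuousLinearMap Bundle Set Filter

/-! ## Part 1. The Fubini–Study form on `W ∖ {0}` -/

namespace Literature.Geometry.Kaehler

variable {W : Type*} [NormedAddCommGroup W] [InnerProductSpace ℂ W]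

/-! ### The potential `1`-form `α₀` and the Fubini–Study form `β₀ = dα₀` -/

/-- The complex inner product of `W` as a real-bilinear continuous map `Z ↦ (a ↦ ⟪Z, a⟫)`
(conjugate-linear, hence only `ℝ`-linear, in `Z`). [folklore] -/
def innerBil : W →L[ℝ] W →L[ℝ] ℂ :=
  (isBoundedBilinearMap_inner (𝕜 := ℂ) (E := W)).toContinuousLinearMap

/-- Unfolding of `innerBil` (definitional). [folklore] -/
@[simp]
theorem innerBil_apply (Z a : W) : innerBil Z a = ⟪Z, a⟫_ℂ := rfl

/-- The coefficient `a ↦ Im ⟪Z, a⟫` of the Fubini–Study potential, a real continuous linear form.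
[folklore] -/
def fsCoeff (Z : W) : W →L[ℝ] ℝ := imCLM.comp (innerBil Z)

/-- Unfolding of `fsCoeff` (definitional). [folklore] -/
@[simp]
theorem fsCoeff_apply (Z a : W) : fsCoeff Z a = (⟪Z, a⟫_ℂ).im := rfl

/-- `Z ↦ fsCoeff Z` is `C^∞` (it is a continuous `ℝ`-linear map). [folklore] -/
theorem contDiff_fsCoeff : ContDiff ℝ ∞ (fun Z : W ↦ fsCoeff Z) := by
  have h := (((ContinuousLinearMap.compL ℝ W ℂ ℝ) imCLM).comp (innerBil (W := W))).contDiff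
    (n := ∞)
  exact h

/-- The **Fubini–Study potential**: the real `1`-form `α₀(Z)(a) = Im ⟪Z, a⟫ / ‖Z‖²` on `W`
(meaningful off `0`; `α₀ = -½ dᶜ log ‖Z‖²` up to sign conventions). Voisin (2002), §3.3.2, proof
of Lemma 3.16. [cite: VoisinHodgeI2002, §3.3.2 Lemma 3.16] -/
def fubiniStudyPotential (Z : W) : W [⋀^Fin 1]→L[ℝ] ℝ :=
  ContinuousAlternatingMap.ofSubsingleton ℝ W ℝ (0 : Fin 1) ((‖Z‖ ^ 2)⁻¹ • fsCoeff Z)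

/-- Evaluation of the Fubini–Study potential: `α₀(Z)(v) = Im⟪Z, v⟫/‖Z‖²` (Voisin (2002), §3.3.2,
proof of Lemma 3.16). [cite: VoisinHodgeI2002, §3.3.2 Lemma 3.16] -/
@[simp]
theorem fubiniStudyPotential_apply (Z : W) (v : Fin 1 → W) :
    fubiniStudyPotential Z v = (‖Z‖ ^ 2)⁻¹ * (⟪Z, v 0⟫_ℂ).im := by
  simp [fubiniStudyPotential]

/-- The **Fubini–Study form** `β₀ := dα₀` on `W` (meaningful off `0`), in Mathlib's normalisation
of `extDeriv`; `β₀ = 2 Im h_FS` (`fubiniStudyForm_apply`). Voisin (2002), §3.3.2.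
[cite: VoisinHodgeI2002, §3.3.2 Lemma 3.16] -/
def fubiniStudyForm (Z : W) : W [⋀^Fin 2]→L[ℝ] ℝ :=
  extDeriv fubiniStudyPotential Z

/-- `minSmoothness ℝ 2 ≤ ∞` (the regularity needed for `d ∘ d = 0` over `ℝ`). [folklore] -/
theorem minSmoothness_two_le_infty : minSmoothness ℝ 2 ≤ ∞ := by
  rw [minSmoothness_of_isRCLikeNormedField]
  exact WithTop.coe_le_coe.2 le_top

/-- The potential is `C^∞` off the origin. [folklore] -/
theorem contDiffAt_fubiniStudyPotential {Z : W} (hZ : Z ≠ 0) :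
    ContDiffAt ℝ ∞ (fubiniStudyPotential (W := W)) Z := by
  have hρ : ContDiffAt ℝ ∞ (fun Y : W ↦ (‖Y‖ ^ 2)⁻¹) Z :=
    ((contDiff_norm_sq ℂ (n := ∞)).contDiffAt).inv (pow_ne_zero 2 (norm_ne_zero_iff.2 hZ))
  have h : ContDiffAt ℝ ∞ (fun Y : W ↦ (‖Y‖ ^ 2)⁻¹ • fsCoeff Y) Z :=
    hρ.smul contDiff_fsCoeff.contDiffAt
  exact (ContinuousAlternatingMap.ofSubsingletonLIE (𝕜 := ℝ) (E := W) (F := ℝ)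
    (0 : Fin 1)).toContinuousLinearEquiv.contDiff.comp_contDiffAt Z h

/-- The potential is `C^∞` on the open set `{Z ≠ 0}`, hence near every `Z ≠ 0`. [folklore] -/
theorem eventually_contDiffAt_fubiniStudyPotential {Z : W} (hZ : Z ≠ 0) :
    ∀ᶠ Y in nhds Z, ContDiffAt ℝ ∞ (fubiniStudyPotential (W := W)) Y := by
  filter_upwards [isOpen_ne.mem_nhds hZ] with Y hY
  exact contDiffAt_fubiniStudyPotential hY

/-- The Fubini–Study form is `C^∞` off the origin. [folklore] -/
theorem contDiffAt_fubiniStudyForm {Z : W} (hZ : Z ≠ 0) :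
    ContDiffAt ℝ ∞ (fubiniStudyForm (W := W)) Z := by
  have h1 : ContDiffAt ℝ ∞ (fderiv ℝ (fubiniStudyPotential (W := W))) Z :=
    (contDiffAt_fubiniStudyPotential hZ).fderiv_right (m := ∞) (by simp)
  exact (ContinuousAlternatingMap.alternatizeUncurryFinCLM ℝ W ℝ (n := 1)).contDiff.comp_contDiffAt
    Z h1

/-- **The Fubini–Study form is closed** off the origin: `dβ₀ = d(dα₀) = 0`
(Voisin (2002), §3.3.1: Chern forms are "clearly closed, since they are locally exact").
[cite: VoisinHodgeI2002, §3.3.1] -/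
theorem extDeriv_fubiniStudyForm {Z : W} (hZ : Z ≠ 0) :
    extDeriv (fubiniStudyForm (W := W)) Z = 0 :=
  extDeriv_extDeriv_apply (r := ∞) (contDiffAt_fubiniStudyPotential hZ) minSmoothness_two_le_infty

/-! ### The explicit formula -/

/-- The derivative of `Y ↦ ‖Y‖²` on the complex inner product space `W` (as a real normed space)
is `a ↦ 2 Re ⟪Z, a⟫`. [folklore] -/
theorem hasFDerivAt_norm_sq_inner (Z : W) :
    HasFDerivAt (fun Y : W ↦ ‖Y‖ ^ 2) ((2 : ℝ) • reCLM.comp (innerBil Z)) Z := by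
  have h := reCLM.hasFDerivAt.comp Z ((hasFDerivAt_id Z).inner ℂ (hasFDerivAt_id Z))
  have hf : (fun Y : W ↦ ‖Y‖ ^ 2) = reCLM ∘ fun Y : W ↦ ⟪id Y, id Y⟫_ℂ := by
    funext Y
    simp only [Function.comp_apply, id_eq, reCLM_apply]
    exact (inner_self_eq_norm_sq (𝕜 := ℂ) Y).symm
  rw [hf]
  refine h.congr_fderiv ?_
  ext a
  simp only [ContinuousLinearMap.comp_apply, reCLM_apply, fderivInnerCLM_apply, id_eq,
    ContinuousLinearMap.prod_apply, ContinuousLinearMap.id_apply, add_re,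
    FunLike.coe_smul, Pi.smul_apply, innerBil_apply, smul_eq_mul]
  have := inner_re_symm (𝕜 := ℂ) a Z
  simp only [RCLike.re_to_complex] at this
  linarith

/-- The derivative of a coefficient `Y ↦ Im ⟪Y, b⟫ / ‖Y‖²` of the potential, evaluated:
`D_a (Im⟪Y,b⟫/‖Y‖²)|_{Y=Z} = Im⟪a,b⟫/‖Z‖² - 2 Re⟪Z,a⟫ Im⟪Z,b⟫/‖Z‖⁴`. [folklore] -/
theorem fderiv_potentialCoeff_apply {Z : W} (hZ : Z ≠ 0) (a b : W) :
    fderiv ℝ (fun Y : W ↦ (‖Y‖ ^ 2)⁻¹ * (⟪Y, b⟫_ℂ).im) Z a =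
      (‖Z‖ ^ 2)⁻¹ * (⟪a, b⟫_ℂ).im
        - 2 * ((‖Z‖ ^ 2) ^ 2)⁻¹ * (⟪Z, a⟫_ℂ).re * (⟪Z, b⟫_ℂ).im := by
  have hne : ‖Z‖ ^ 2 ≠ 0 := pow_ne_zero 2 (norm_ne_zero_iff.2 hZ)
  have hinv : HasFDerivAt (fun Y : W ↦ (‖Y‖ ^ 2)⁻¹)
      ((toSpanSingleton ℝ (-((‖Z‖ ^ 2) ^ 2)⁻¹)).comp ((2 : ℝ) • reCLM.comp (innerBil Z))) Z :=
    (hasFDerivAt_inv hne).comp Z (hasFDerivAt_norm_sq_inner Z)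
  have him : HasFDerivAt (fun Y : W ↦ (⟪Y, b⟫_ℂ).im) (imCLM.comp ((innerBil (W := W)).flip b)) Z :=
    (imCLM.comp ((innerBil (W := W)).flip b)).hasFDerivAt
  have hmul : HasFDerivAt (fun Y : W ↦ (‖Y‖ ^ 2)⁻¹ * (⟪Y, b⟫_ℂ).im) _ Z := hinv.mul him
  rw [hmul.fderiv]
  simp only [add_apply, FunLike.coe_smul, Pi.smul_apply, ContinuousLinearMap.comp_apply,
    ContinuousLinearMap.flip_apply, innerBil_apply, imCLM_apply, reCLM_apply,
    toSpanSingleton_apply, smul_eq_mul]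
  ring

/-- **The Fubini–Study form, explicitly**: for `Z ≠ 0`,
`β₀(Z)(v₀, v₁) = 2 Im⟪v₀,v₁⟫/‖Z‖² - 2 (Re⟪Z,v₀⟫ Im⟪Z,v₁⟫ - Re⟪Z,v₁⟫ Im⟪Z,v₀⟫)/‖Z‖⁴`, i.e.
`β₀ = 2 Im h_FS`, `h_FS(Z)(a,b) = (⟪a,b⟫‖Z‖² - ⟪a,Z⟫⟪Z,b⟫)/‖Z‖⁴` (Voisin (2002), §3.3.2, the
displayed formula for `ωᵢ` in the proof of Lemma 3.16, lifted to `W ∖ {0}`).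
[cite: VoisinHodgeI2002, §3.3.2 Lemma 3.16] -/
theorem fubiniStudyForm_apply {Z : W} (hZ : Z ≠ 0) (v : Fin 2 → W) :
    fubiniStudyForm Z v =
      2 * (‖Z‖ ^ 2)⁻¹ * (⟪v 0, v 1⟫_ℂ).im
        - 2 * ((‖Z‖ ^ 2) ^ 2)⁻¹ *
          ((⟪Z, v 0⟫_ℂ).re * (⟪Z, v 1⟫_ℂ).im - (⟪Z, v 1⟫_ℂ).re * (⟪Z, v 0⟫_ℂ).im) := by
  have hdiff : DifferentiableAt ℝ (fubiniStudyPotential (W := W)) Z :=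
    (contDiffAt_fubiniStudyPotential hZ).differentiableAt (by simp)
  rw [fubiniStudyForm, extDeriv_apply hdiff, Fin.sum_univ_two]
  simp only [fubiniStudyPotential_apply, Fin.removeNth, Fin.succAbove_zero, Fin.succ_zero_eq_one,
    Fin.one_succAbove_zero, Fin.val_zero, Fin.val_one, fderiv_potentialCoeff_apply hZ]
  have h10 : (⟪v 1, v 0⟫_ℂ).im = -(⟪v 0, v 1⟫_ℂ).im := by
    rw [← inner_conj_symm, conj_im]
  rw [h10]
  ring

/-! ### Linear algebra of the Fubini–Study form: type `(1,1)`, positivity, projective invariance -/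

section Algebra

variable {Z : W}

/-- `⟪Z, Z⟫ = ‖Z‖²` as a complex number with vanishing imaginary part. [folklore] -/
theorem inner_self_re_im (Z : W) : (⟪Z, Z⟫_ℂ).re = ‖Z‖ ^ 2 ∧ (⟪Z, Z⟫_ℂ).im = 0 := by
  have h : ⟪Z, Z⟫_ℂ = ((‖Z‖ ^ 2 : ℝ) : ℂ) := by
    rw [inner_self_eq_norm_sq_to_K]
    push_cast
    rfl
  rw [h]
  exact ⟨Complex.ofReal_re _, Complex.ofReal_im _⟩

/-- Hermitian symmetry on real and imaginary parts: `Re⟪a,Z⟫ = Re⟪Z,a⟫`, `Im⟪a,Z⟫ = -Im⟪Z,a⟫`.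
[folklore] -/
theorem inner_re_im_symm (a Z : W) :
    (⟪a, Z⟫_ℂ).re = (⟪Z, a⟫_ℂ).re ∧ (⟪a, Z⟫_ℂ).im = -(⟪Z, a⟫_ℂ).im := by
  rw [← inner_conj_symm a Z, conj_re, conj_im]
  exact ⟨rfl, rfl⟩

/-- **`β₀` is of type `(1,1)`**: it is invariant under the complex structure,
`β₀(Z)(ia, ib) = β₀(Z)(a, b)` (Voisin (2002), §3.3.1: Chern forms are "real of type `(1,1)`";
§3.1.1 Lemma 3.3). [cite: VoisinHodgeI2002, §3.3.1] -/
theorem fubiniStudyForm_I_smul (hZ : Z ≠ 0) (a b : W) :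
    fubiniStudyForm Z ![I • a, I • b] = fubiniStudyForm Z ![a, b] := by
  simp only [fubiniStudyForm_apply hZ, Matrix.cons_val_zero, Matrix.cons_val_one,
    inner_smul_left, inner_smul_right, Complex.conj_I, mul_re, mul_im, neg_re, neg_im, I_re, I_im]
  ring

/-- **The Fubini–Study form on `(a, ia)`**:
`β₀(Z)(a, ia) = 2 (‖Z‖² ‖a‖² - |⟪Z, a⟫|²) / ‖Z‖⁴` (twice the Fubini–Study norm of the
component of `a` orthogonal to `Z`; Voisin (2002), §3.3.2, proof of Lemma 3.16).
[cite: VoisinHodgeI2002, §3.3.2 Lemma 3.16] -/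
theorem fubiniStudyForm_self_I_smul (hZ : Z ≠ 0) (a : W) :
    fubiniStudyForm Z ![a, I • a] =
      2 * ((‖Z‖ ^ 2) ^ 2)⁻¹ * (‖Z‖ ^ 2 * ‖a‖ ^ 2 - ‖⟪Z, a⟫_ℂ‖ ^ 2) := by
  have hne : ‖Z‖ ^ 2 ≠ 0 := pow_ne_zero 2 (norm_ne_zero_iff.2 hZ)
  obtain ⟨ha_re, ha_im⟩ := inner_self_re_im a
  simp only [fubiniStudyForm_apply hZ, Matrix.cons_val_zero, Matrix.cons_val_one,
    inner_smul_right, mul_re, mul_im, I_re, I_im, ha_re, ha_im, Complex.sq_norm,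
    Complex.normSq_apply]
  field_simp
  ring

/-- **Positivity of the Fubini–Study form** (Voisin (2002), §3.3.2, Lemma 3.16: "the form `ω`
defined this way on `ℙⁿ(ℂ)` is positive"): `β₀(Z)(a, ia) ≥ 0`, by Cauchy–Schwarz.
[cite: VoisinHodgeI2002, §3.3.2 Lemma 3.16] -/
theorem fubiniStudyForm_self_I_smul_nonneg (hZ : Z ≠ 0) (a : W) :
    0 ≤ fubiniStudyForm Z ![a, I • a] := by
  rw [fubiniStudyForm_self_I_smul hZ]
  have h1 : ‖⟪Z, a⟫_ℂ‖ ^ 2 ≤ ‖Z‖ ^ 2 * ‖a‖ ^ 2 := by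
    rw [← mul_pow]
    exact pow_le_pow_left₀ (norm_nonneg _) (norm_inner_le_norm Z a) 2
  have h2 : 0 ≤ ((‖Z‖ ^ 2) ^ 2)⁻¹ := inv_nonneg.2 (sq_nonneg _)
  nlinarith

/-- **Kernel of the Fubini–Study form** (equality in Cauchy–Schwarz): if `β₀(Z)(a, ia) = 0`
then `a` is a complex multiple of `Z` — the form is positive definite transversally to the
fibres of `W ∖ {0} → ℙ(W)` (Voisin (2002), §3.3.2, Lemma 3.16). [cite: VoisinHodgeI2002, §3.3.2 Lemma 3.16] -/
theorem exists_eq_smul_of_fubiniStudyForm_self_I_smul_eq_zero (hZ : Z ≠ 0) {a : W}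
    (h : fubiniStudyForm Z ![a, I • a] = 0) : ∃ r : ℂ, a = r • Z := by
  by_cases ha : a = 0
  · exact ⟨0, by simp [ha]⟩
  have hne : ‖Z‖ ^ 2 ≠ 0 := pow_ne_zero 2 (norm_ne_zero_iff.2 hZ)
  rw [fubiniStudyForm_self_I_smul hZ] at h
  have h1 : ‖Z‖ ^ 2 * ‖a‖ ^ 2 - ‖⟪Z, a⟫_ℂ‖ ^ 2 = 0 := by
    have h2 : (2 * ((‖Z‖ ^ 2) ^ 2)⁻¹ : ℝ) ≠ 0 :=
      mul_ne_zero two_ne_zero (inv_ne_zero (pow_ne_zero 2 hne))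
    exact (mul_eq_zero.1 h).resolve_left h2
  have h3 : ‖⟪Z, a⟫_ℂ‖ = ‖Z‖ * ‖a‖ := by
    rw [← pow_left_inj₀ (norm_nonneg _) (by positivity) two_ne_zero, mul_pow]
    linarith
  obtain ⟨r, -, hr⟩ := (norm_inner_eq_norm_iff (𝕜 := ℂ) hZ ha).1 h3
  exact ⟨r, hr⟩

/-- Invariance of `β₀(Z)` under translation of the first argument along `Z`. [folklore] -/
theorem fubiniStudyForm_add_smul_left (hZ : Z ≠ 0) (a b : W) (μ : ℂ) :
    fubiniStudyForm Z ![a + μ • Z, b] = fubiniStudyForm Z ![a, b] := by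
  have hne : ‖Z‖ ^ 2 ≠ 0 := pow_ne_zero 2 (norm_ne_zero_iff.2 hZ)
  obtain ⟨hZ_re, hZ_im⟩ := inner_self_re_im Z
  simp only [fubiniStudyForm_apply hZ, Matrix.cons_val_zero, Matrix.cons_val_one,
    inner_add_left, inner_add_right, inner_smul_left, inner_smul_right, add_re, add_im, mul_re,
    mul_im, conj_re, conj_im, hZ_re, hZ_im]
  field_simp
  ring

/-- Invariance of `β₀(Z)` under translation of the second argument along `Z`. [folklore] -/
theorem fubiniStudyForm_add_smul_right (hZ : Z ≠ 0) (a b : W) (ν : ℂ) :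
    fubiniStudyForm Z ![a, b + ν • Z] = fubiniStudyForm Z ![a, b] := by
  have hne : ‖Z‖ ^ 2 ≠ 0 := pow_ne_zero 2 (norm_ne_zero_iff.2 hZ)
  obtain ⟨hZ_re, hZ_im⟩ := inner_self_re_im Z
  obtain ⟨haZ_re, haZ_im⟩ := inner_re_im_symm a Z
  simp only [fubiniStudyForm_apply hZ, Matrix.cons_val_zero, Matrix.cons_val_one,
    inner_add_right, inner_smul_right, add_re, add_im, mul_re, mul_im, hZ_re, hZ_im, haZ_re,
    haZ_im]
  field_simp
  ring

/-- Invariance of `β₀` under simultaneous complex rescaling: `β₀(cZ)(ca, cb) = β₀(Z)(a, b)` for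
`c ≠ 0`. [folklore] -/
theorem fubiniStudyForm_smul_smul (hZ : Z ≠ 0) {c : ℂ} (hc : c ≠ 0) (a b : W) :
    fubiniStudyForm (c • Z) ![c • a, c • b] = fubiniStudyForm Z ![a, b] := by
  have hne : ‖Z‖ ^ 2 ≠ 0 := pow_ne_zero 2 (norm_ne_zero_iff.2 hZ)
  have hcZ : c • Z ≠ 0 := smul_ne_zero hc hZ
  have hr : ‖c‖ ^ 2 ≠ 0 := pow_ne_zero 2 (norm_ne_zero_iff.2 hc)
  have hcc : ∀ x y : W, ⟪c • x, c • y⟫_ℂ = ((‖c‖ ^ 2 : ℝ) : ℂ) * ⟪x, y⟫_ℂ := fun x y ↦ by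
    rw [inner_smul_left, inner_smul_right, ← mul_assoc, mul_comm ((starRingEnd ℂ) c) c,
      Complex.mul_conj, Complex.normSq_eq_norm_sq]
  simp only [fubiniStudyForm_apply hZ, fubiniStudyForm_apply hcZ, Matrix.cons_val_zero,
    Matrix.cons_val_one, hcc, Complex.re_ofReal_mul, Complex.im_ofReal_mul, norm_smul, mul_pow]
  generalize ‖c‖ ^ 2 = r at hr ⊢
  field_simp

/-- **Projective invariance of the Fubini–Study form**: for `c ≠ 0`,
`β₀(cZ)(ca + μZ, cb + νZ) = β₀(Z)(a, b)`. Equivalently `β₀` is the pull-back to `W ∖ {0}` of a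
form on `ℙ(W)`, and for a holomorphic map `G` into `W ∖ {0}` and a holomorphic function `f ≠ 0`
the pull-backs of `β₀` along `G` and `fG` coincide (`d(fG) = f dG + df ⊗ G`). Voisin (2002),
§3.3.1–3.3.2 (the local forms `ωᵢ` "coincide on `Uᵢ ∩ Uⱼ`"). [cite: VoisinHodgeI2002, §3.3.1] -/
theorem fubiniStudyForm_smul_add_smul (hZ : Z ≠ 0) {c : ℂ} (hc : c ≠ 0) (μ ν : ℂ) (a b : W) :
    fubiniStudyForm (c • Z) ![c • a + μ • Z, c • b + ν • Z] = fubiniStudyForm Z ![a, b] := by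
  have hcZ : c • Z ≠ 0 := smul_ne_zero hc hZ
  have h1 : c • a + μ • Z = c • a + (μ * c⁻¹) • (c • Z) := by
    rw [smul_smul, inv_mul_cancel_right₀ hc]
  have h2 : c • b + ν • Z = c • b + (ν * c⁻¹) • (c • Z) := by
    rw [smul_smul, inv_mul_cancel_right₀ hc]
  rw [h1, h2, fubiniStudyForm_add_smul_left hcZ, fubiniStudyForm_add_smul_right hcZ,
    fubiniStudyForm_smul_smul hZ hc]

end Algebra

end Literature.Geometry.Kaehler

/-! ## Part 2. The pull-back along a holomorphic map -/

namespace Literature.Geometry.Kaehler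

/-! ### Forms on the model vector space: smoothness is `ContDiffAt` -/

section Model

variable {V : Type*} [NormedAddCommGroup V] [NormedSpace ℝ V]
  {F : Type*} [NormedAddCommGroup F] [NormedSpace ℝ F] {k : ℕ}

/-- On a vector space regarded as a manifold modelled on itself, the chart representative of a
form is the form itself (the charts are the identity). [folklore] -/
theorem MForm.inChart_model (β : MForm 𝓘(ℝ, V) V F k) (x : V) : β.inChart x = β := by
  funext y
  ext v
  simp [MForm.inChart_apply]
  rfl

/-- On a vector space regarded as a manifold modelled on itself, smoothness of a form at a point
is `ContDiffAt` of the form as a map `V → V [⋀^Fin k]→L[ℝ] F`. [folklore] -/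
theorem MForm.smoothAt_model_iff (β : MForm 𝓘(ℝ, V) V F k) (x : V) :
    β.SmoothAt x ↔ @ContDiffAt ℝ _ V _ _ (V [⋀^Fin k]→L[ℝ] F) _ _ ∞ β x := by
  rw [MForm.SmoothAt, MForm.inChart_model]
  simp only [modelWithCornersSelf_coe, range_id, extChartAt_model_space_eq_id,
    PartialEquiv.refl_coe, id_eq, contDiffWithinAt_univ]

end Model

/-! ### The pulled-back Fubini–Study form -/

variable {E : Type*} [NormedAddCommGroup E] [NormedSpace ℂ E]
  {M : Type*} [TopologicalSpace M] [ChartedSpace E M]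
  {W : Type*} [NormedAddCommGroup W] [InnerProductSpace ℂ W]

/-- The Fubini–Study form `β₀ = dα₀` of `W ∖ {0}` as a form on the manifold `W` (modelled on
itself). [cite: VoisinHodgeI2002, §3.3.2 Lemma 3.16] -/
def fubiniStudyMForm : MForm 𝓘(ℝ, W) W ℝ 2 := fun Z ↦ (fubiniStudyForm Z :)

/-- Unfolding of `fubiniStudyMForm` (definitional). [folklore] -/
@[simp]
theorem fubiniStudyMForm_apply (Z : W) :
    fubiniStudyMForm (W := W) Z = (fubiniStudyForm Z :) := rfl

variable (E) in
/-- **The pulled-back Fubini–Study form** `θ_G = G^* β₀` of a map `G : M → W` (meaningful where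
`G` is holomorphic and non-zero): the Kähler form of the metric induced through `[G] : M → ℙ(W)` by
the Fubini–Study metric (Voisin (2002), §3.1.3 and §3.3.2). [cite: VoisinHodgeI2002, §3.3.2] -/
def fsPullback (G : M → W) : MForm 𝓘(ℝ, E) M ℝ 2 :=
  (fubiniStudyMForm (W := W)).pullback 𝓘(ℝ, E) G

/-- Any `v : Fin 2 → X` is the pair `![v 0, v 1]`. [folklore] -/
theorem eq_vecCons_two {X : Type*} (v : Fin 2 → X) : v = ![v 0, v 1] := by
  funext i
  fin_cases i <;> rfl

/-- Evaluation of the pulled-back Fubini–Study form: `θ_G(m)(v, w) = β₀(G m)(dG_m v, dG_m w)`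
with `dG_m = mvfderiv 𝓘(ℝ, E) G m` the real differential, valued in `W`.
[cite: VoisinHodgeI2002, §3.1.3] -/
theorem fsPullback_apply (G : M → W) (m : M) (v w : TangentSpace 𝓘(ℝ, E) m) :
    fsPullback E G m ![v, w] =
      fubiniStudyForm (G m) ![mvfderiv 𝓘(ℝ, E) G m v, mvfderiv 𝓘(ℝ, E) G m w] := by
  simp only [fsPullback, MForm.pullback_apply, fubiniStudyMForm_apply]
  congr 1
  funext i
  fin_cases i <;> rfl

/-- Evaluation of the pulled-back Fubini–Study form on a general pair. [cite: VoisinHodgeI2002, §3.1.3] -/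
theorem fsPullback_apply' (G : M → W) (m : M) (v : Fin 2 → TangentSpace 𝓘(ℝ, E) m) :
    fsPullback E G m v =
      fubiniStudyForm (G m) ![mvfderiv 𝓘(ℝ, E) G m (v 0), mvfderiv 𝓘(ℝ, E) G m (v 1)] := by
  rw [eq_vecCons_two v, fsPullback_apply]
  rfl

/-- `mvfderiv` only depends on the germ of the map. [folklore] -/
theorem mvfderiv_congr_of_eventuallyEq {F' : Type*} [NormedAddCommGroup F'] [NormedSpace ℝ F']
    {g g' : M → F'} {x : M} (h : g =ᶠ[𝓝 x] g') :
    mvfderiv 𝓘(ℝ, E) g x = mvfderiv 𝓘(ℝ, E) g' x := by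
  have h1 := h.mfderiv_eq (I := 𝓘(ℝ, E)) (I' := 𝓘(ℝ, F'))
  ext v
  exact congrArg (fun L : TangentSpace 𝓘(ℝ, E) x →L[ℝ] TangentSpace 𝓘(ℝ, F') (g x) ↦
    (show F' from L v)) h1

/-- `θ_G(m)` only depends on the germ of `G` at `m`. [folklore] -/
theorem fsPullback_congr_of_eventuallyEq {G G' : M → W} {m : M} (h : G =ᶠ[𝓝 m] G') :
    fsPullback E G m = fsPullback E G' m := by
  ext v
  rw [fsPullback_apply', fsPullback_apply', mvfderiv_congr_of_eventuallyEq h, h.self_of_nhds]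

/-- **The real differential of a holomorphic map is its complex differential** (valued in the
target vector space): `mvfderiv 𝓘(ℝ, E) g x v = mvfderiv 𝓘(ℂ, E) g x v` (restriction of scalars,
`mfderiv_real_eq_restrictScalars`; Voisin (2002), §2.2.1). [cite: VoisinHodgeI2002, §2.2.1] -/
theorem mvfderiv_real_apply_eq_complex {F' : Type*} [NormedAddCommGroup F'] [NormedSpace ℂ F']
    {g : M → F'} {x : M} (hg : MDifferentiableAt 𝓘(ℂ, E) 𝓘(ℂ, F') g x)
    (v : TangentSpace 𝓘(ℝ, E) x) :
    mvfderiv 𝓘(ℝ, E) g x v = mvfderiv 𝓘(ℂ, E) g x v := by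
  have h := congrArg (fun L : TangentSpace 𝓘(ℝ, E) x →L[ℝ] TangentSpace 𝓘(ℝ, F') (g x) ↦
    (show F' from L v)) (Literature.NumberTheory.Transcendental.mfderiv_real_eq_restrictScalars hg)
  exact h

/-- The real differential of a holomorphic map commutes with `i`:
`mvfderiv 𝓘(ℝ, E) g x (i • v) = i • mvfderiv 𝓘(ℝ, E) g x v` (Voisin (2002), §2.2.1).
[cite: VoisinHodgeI2002, §2.2.1] -/
theorem mvfderiv_real_apply_I_smul {F' : Type*} [NormedAddCommGroup F'] [NormedSpace ℂ F']
    {g : M → F'} {x : M} (hg : MDifferentiableAt 𝓘(ℂ, E) 𝓘(ℂ, F') g x)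
    (v : TangentSpace 𝓘(ℝ, E) x) :
    mvfderiv 𝓘(ℝ, E) g x (tangentJ E x v) = I • mvfderiv 𝓘(ℝ, E) g x v := by
  rw [tangentJ_apply, mvfderiv_real_apply_eq_complex hg, mvfderiv_real_apply_eq_complex hg]
  exact (mfderiv 𝓘(ℂ, E) 𝓘(ℂ, F') g x).map_smul I v

section Smooth

variable [FiniteDimensional ℂ E] [IsManifold 𝓘(ℂ, E) ω M] [IsManifold 𝓘(ℝ, E) ∞ M]
  [FiniteDimensional ℂ W]
  {G : M → W} {U : Set M}

/-- A map holomorphic on an open set is real `C^∞` near each of its points. [folklore] -/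
theorem eventually_contMDiffAt_real (hG : MDifferentiableOn 𝓘(ℂ, E) 𝓘(ℂ, W) G U)
    (hU : IsOpen U) {m : M} (hm : m ∈ U) :
    ∀ᶠ z in 𝓝 m, ContMDiffAt 𝓘(ℝ, E) 𝓘(ℝ, W) ∞ G z := by
  filter_upwards [hU.mem_nhds hm] with z hz
  exact contMDiffAt_real_of_mdifferentiableOn_complex hG hU hz

/-- **`θ_G` is smooth** at the points of `U` (`G` holomorphic on the open set `U`, `G m ≠ 0`):
pull-back of the `C^∞` form `β₀` (smooth off `0`) along a `C^∞` map. Voisin (2002), §3.1.3.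
[cite: VoisinHodgeI2002, §3.1.3] -/
theorem smoothAt_fsPullback (hG : MDifferentiableOn 𝓘(ℂ, E) 𝓘(ℂ, W) G U) (hU : IsOpen U)
    {m : M} (hm : m ∈ U) (h0 : G m ≠ 0) : (fsPullback E G).SmoothAt m :=
  MForm.SmoothAt.pullback (eventually_contMDiffAt_real hG hU hm)
    ((MForm.smoothAt_model_iff (fubiniStudyMForm (W := W)) _).2 (contDiffAt_fubiniStudyForm h0))

/-- **`θ_G` is closed** at the points of `U`: `d(G^*β₀) = G^*(dβ₀) = G^*(ddα₀) = 0` (Voisin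
(2002), §3.1.3: "As `ω_N` is closed …"; §3.3.1: locally exact forms are closed).
[cite: VoisinHodgeI2002, §3.1.3] -/
theorem mextDeriv_fsPullback (hG : MDifferentiableOn 𝓘(ℂ, E) 𝓘(ℂ, W) G U) (hU : IsOpen U)
    {m : M} (hm : m ∈ U) (h0 : G m ≠ 0) : mextDeriv (fsPullback E G) m = 0 := by
  have hd : mextDeriv (fubiniStudyMForm (W := W)) (G m) = 0 := by
    rw [mextDeriv_eq_extDeriv]
    exact extDeriv_fubiniStudyForm h0
  rw [fsPullback, mextDeriv_pullback_apply (eventually_contMDiffAt_real hG hU hm)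
    ((MForm.smoothAt_model_iff (fubiniStudyMForm (W := W)) _).2 (contDiffAt_fubiniStudyForm h0))]
  ext v
  simp [MForm.pullback_apply, hd]

end Smooth

section Pointwise

variable {G : M → W} {m : M}

/-- **`θ_G` is of type `(1,1)`**: `θ_G(Jv, Jw) = θ_G(v, w)`, because the differential of the
holomorphic map `G` is `ℂ`-linear and `β₀` is `J`-invariant (Voisin (2002), §3.1.1 Lemma 3.3,
§3.3.1). [cite: VoisinHodgeI2002, §3.3.1] -/
theorem fsPullback_tangentJ (hG : MDifferentiableAt 𝓘(ℂ, E) 𝓘(ℂ, W) G m) (h0 : G m ≠ 0)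
    (v w : TangentSpace 𝓘(ℝ, E) m) :
    fsPullback E G m ![tangentJ E m v, tangentJ E m w] = fsPullback E G m ![v, w] := by
  rw [fsPullback_apply, fsPullback_apply, mvfderiv_real_apply_I_smul hG,
    mvfderiv_real_apply_I_smul hG]
  exact fubiniStudyForm_I_smul h0 _ _

/-- **Semi-positivity of `θ_G`**: `θ_G(v, Jv) ≥ 0` (Voisin (2002), §3.3.2, Lemma 3.16).
[cite: VoisinHodgeI2002, §3.3.2 Lemma 3.16] -/
theorem fsPullback_self_tangentJ_nonneg (hG : MDifferentiableAt 𝓘(ℂ, E) 𝓘(ℂ, W) G m)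
    (h0 : G m ≠ 0) (v : TangentSpace 𝓘(ℝ, E) m) :
    0 ≤ fsPullback E G m ![v, tangentJ E m v] := by
  rw [fsPullback_apply, mvfderiv_real_apply_I_smul hG]
  exact fubiniStudyForm_self_I_smul_nonneg h0 _

/-- **Kernel of `θ_G(·, J·)`**: if `θ_G(v, Jv) = 0` then the (complex) differential `dG_m v` is a
complex multiple of `G m`, i.e. `d[G]_m v = 0` in `T ℙ(W)` (Voisin (2002), §3.3.2, Lemma 3.16:
`ω_FS` is positive). [cite: VoisinHodgeI2002, §3.3.2 Lemma 3.16] -/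
theorem exists_mvfderiv_eq_smul_of_fsPullback_eq_zero
    (hG : MDifferentiableAt 𝓘(ℂ, E) 𝓘(ℂ, W) G m) (h0 : G m ≠ 0) {v : TangentSpace 𝓘(ℝ, E) m}
    (h : fsPullback E G m ![v, tangentJ E m v] = 0) :
    ∃ r : ℂ, mvfderiv 𝓘(ℂ, E) G m v = r • G m := by
  rw [fsPullback_apply, mvfderiv_real_apply_I_smul hG, mvfderiv_real_apply_eq_complex hG] at h
  exact exists_eq_smul_of_fubiniStudyForm_self_I_smul_eq_zero h0 h

/-- **Projective invariance of `θ_G`**: for `f : M → ℂ` and `G` holomorphic at `m` with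
`f m ≠ 0`, `G m ≠ 0`, the forms `θ_{fG}` and `θ_G` agree at `m`: `d(fG) = f dG + df ⊗ G` and
`β₀(cZ)(ca + μZ, cb + νZ) = β₀(Z)(a, b)`. This is why the local forms glue (Voisin (2002), §3.3.1:
the `ωᵢ` "coincide on `Uᵢ ∩ Uⱼ`"). [cite: VoisinHodgeI2002, §3.3.1] -/
theorem fsPullback_smul {f : M → ℂ} (hf : MDifferentiableAt 𝓘(ℂ, E) 𝓘(ℂ, ℂ) f m)
    (hG : MDifferentiableAt 𝓘(ℂ, E) 𝓘(ℂ, W) G m) (hf0 : f m ≠ 0) (h0 : G m ≠ 0) :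
    fsPullback E (fun x ↦ f x • G x) m = fsPullback E G m := by
  have hfG : MDifferentiableAt 𝓘(ℂ, E) 𝓘(ℂ, W) (fun x ↦ f x • G x) m := hf.smul hG
  -- `d(fG) v = f(m) dG v + (df v) G(m)`, for the complex differentials valued in `W`
  have key : ∀ v : TangentSpace 𝓘(ℝ, E) m,
      mvfderiv 𝓘(ℝ, E) (fun x ↦ f x • G x) m v =
        f m • mvfderiv 𝓘(ℝ, E) G m v + (mvfderiv 𝓘(ℂ, E) f m v) • G m := by
    intro v
    rw [mvfderiv_real_apply_eq_complex hfG, mvfderiv_real_apply_eq_complex hG,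
      mvfderiv_fun_smul hf hG]
    simp
  ext v
  rw [fsPullback_apply', fsPullback_apply', key, key]
  exact fubiniStudyForm_smul_add_smul h0 hf0 _ _ _ _

end Pointwise

end Literature.Geometry.Kaehler

/-! ## Part 3. A closed positive real `(1,1)`-form is the Kähler form of a Kähler metric -/

namespace Literature.Geometry.Kaehler

section TwoForms

variable {V : Type*} [AddCommGroup V] [Module ℝ V] [TopologicalSpace V]

/-- Additivity of a `2`-form in its first argument. [folklore] -/
theorem cam₂_add_left (A : V [⋀^Fin 2]→L[ℝ] ℝ) (v₁ v₂ w : V) :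
    A ![v₁ + v₂, w] = A ![v₁, w] + A ![v₂, w] :=
  A.toContinuousMultilinearMap.cons_add _ _ _

/-- Homogeneity of a `2`-form in its first argument. [folklore] -/
theorem cam₂_smul_left (A : V [⋀^Fin 2]→L[ℝ] ℝ) (c : ℝ) (v w : V) :
    A ![c • v, w] = c • A ![v, w] :=
  A.toContinuousMultilinearMap.cons_smul _ _ _

/-- Antisymmetry of a `2`-form on a pair. [folklore] -/
theorem cam₂_swap (A : V [⋀^Fin 2]→L[ℝ] ℝ) (v w : V) : A ![v, w] = -A ![w, v] := by
  classical
  have h := A.map_swap ![w, v] (show (0 : Fin 2) ≠ 1 by decide)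
  have hv : (![w, v] ∘ Equiv.swap (0 : Fin 2) 1) = ![v, w] := by
    funext i
    fin_cases i <;> rfl
  rw [hv] at h
  exact h

/-- Additivity of a `2`-form in its second argument. [folklore] -/
theorem cam₂_add_right (A : V [⋀^Fin 2]→L[ℝ] ℝ) (v w₁ w₂ : V) :
    A ![v, w₁ + w₂] = A ![v, w₁] + A ![v, w₂] := by
  rw [cam₂_swap A v, cam₂_add_left, cam₂_swap A v w₁, cam₂_swap A v w₂]
  ring

/-- Homogeneity of a `2`-form in its second argument. [folklore] -/
theorem cam₂_smul_right (A : V [⋀^Fin 2]→L[ℝ] ℝ) (c : ℝ) (v w : V) :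
    A ![v, c • w] = c • A ![v, w] := by
  rw [cam₂_swap A v, cam₂_smul_left, cam₂_swap A v w, smul_neg]

/-- A `2`-form changes sign under negation of its second argument. [folklore] -/
theorem cam₂_neg_right (A : V [⋀^Fin 2]→L[ℝ] ℝ) (v w : V) : A ![v, -w] = -A ![v, w] := by
  rw [← neg_one_smul ℝ w, cam₂_smul_right, neg_one_smul]

end TwoForms

section TwistBilin

variable {E : Type*} [NormedAddCommGroup E] [NormedSpace ℂ E]

/-- **The bilinear form `(v, w) ↦ A(v, iw)` attached to a real `2`-form `A`** on the complex normed
space `E` (for `A = ω` the Kähler form of a Hermitian metric this is the metric,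
`g(u, v) = ω(u, Iv)`; Voisin (2002), §3.1.1, the line after (3.1)). A continuous real-bilinear
form, bounded by `‖A‖`. [cite: VoisinHodgeI2002, §3.1.1 Lemma 3.3] -/
def twistBilin (A : E [⋀^Fin 2]→L[ℝ] ℝ) : E →L[ℝ] E →L[ℝ] ℝ :=
  LinearMap.mkContinuous₂
    (LinearMap.mk₂ ℝ (fun v w ↦ A ![v, I • w]) (fun v₁ v₂ w ↦ cam₂_add_left A v₁ v₂ _)
      (fun c v w ↦ cam₂_smul_left A c v _)
      (fun v w₁ w₂ ↦ by simp only [smul_add, cam₂_add_right])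
      (fun c v w ↦ by rw [smul_comm I c w, cam₂_smul_right]))
    ‖A‖ (fun v w ↦ by
      refine (A.le_opNorm ![v, I • w]).trans (le_of_eq ?_)
      simp [Fin.prod_univ_two, norm_smul, mul_assoc])

/-- Unfolding of `twistBilin`: `twistBilin A v w = A(v, iw)` (definitional; Voisin (2002), §3.1.1,
`g(u, v) = ω(u, Iv)`). [cite: VoisinHodgeI2002, §3.1.1 Lemma 3.3] -/
@[simp]
theorem twistBilin_apply (A : E [⋀^Fin 2]→L[ℝ] ℝ) (v w : E) : twistBilin A v w = A ![v, I • w] :=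
  rfl

/-- `A ↦ twistBilin A` is a bounded linear map, hence `C^∞`. [folklore] -/
theorem contDiff_twistBilin : ContDiff ℝ ∞ (twistBilin (E := E)) := by
  refine IsBoundedLinearMap.contDiff ⟨⟨fun A A' ↦ ?_, fun c A ↦ ?_⟩, 1, one_pos, fun A ↦ ?_⟩
  · ext v w
    simp
  · ext v w
    simp
  · rw [one_mul]
    exact LinearMap.mkContinuous₂_norm_le _ (norm_nonneg A) _

/-- **Coercivity of a positive definite form in finite dimension**: a continuous bilinear form `B`
on a finite-dimensional space with `B(v, v) > 0` for `v ≠ 0` satisfies `c ‖v‖² ≤ B(v, v)` for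
some `c > 0` (minimum on the unit sphere, which is compact). [folklore] -/
theorem exists_pos_mul_norm_sq_le {V : Type*} [NormedAddCommGroup V] [NormedSpace ℝ V]
    [FiniteDimensional ℝ V] (B : V →L[ℝ] V →L[ℝ] ℝ) (hB : ∀ v, v ≠ 0 → 0 < B v v) :
    ∃ c : ℝ, 0 < c ∧ ∀ v, c * ‖v‖ ^ 2 ≤ B v v := by
  have hcont : Continuous fun v : V ↦ B v v :=
    B.continuous₂.comp (continuous_id.prodMk continuous_id)
  rcases (Metric.sphere (0 : V) 1).eq_empty_or_nonempty with hS | hS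
  · refine ⟨1, one_pos, fun v ↦ ?_⟩
    by_cases hv : v = 0
    · subst hv
      simp
    · exfalso
      have : ‖v‖⁻¹ • v ∈ Metric.sphere (0 : V) 1 := by
        rw [mem_sphere_zero_iff_norm, norm_smul, norm_inv, norm_norm,
          inv_mul_cancel₀ (norm_ne_zero_iff.2 hv)]
      rw [hS] at this
      exact this
  · obtain ⟨u₀, hu₀, hmin⟩ :=
      (isCompact_sphere (0 : V) 1).exists_isMinOn hS hcont.continuousOn
    have hu₀0 : u₀ ≠ 0 := by
      intro h
      rw [h, mem_sphere_zero_iff_norm, norm_zero] at hu₀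
      exact zero_ne_one hu₀
    refine ⟨B u₀ u₀, hB u₀ hu₀0, fun v ↦ ?_⟩
    by_cases hv : v = 0
    · subst hv
      simp
    · have hvn : ‖v‖ ≠ 0 := norm_ne_zero_iff.2 hv
      have hu : ‖v‖⁻¹ • v ∈ Metric.sphere (0 : V) 1 := by
        rw [mem_sphere_zero_iff_norm, norm_smul, norm_inv, norm_norm, inv_mul_cancel₀ hvn]
      have h1 : B u₀ u₀ ≤ B (‖v‖⁻¹ • v) (‖v‖⁻¹ • v) := hmin hu
      have h2 : B (‖v‖⁻¹ • v) (‖v‖⁻¹ • v) = (‖v‖ ^ 2)⁻¹ * B v v := by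
        simp only [map_smul, FunLike.coe_smul, Pi.smul_apply, smul_eq_mul]
        field_simp
      rw [h2] at h1
      have h3 : 0 < ‖v‖ ^ 2 := by positivity
      calc B u₀ u₀ * ‖v‖ ^ 2 ≤ (‖v‖ ^ 2)⁻¹ * B v v * ‖v‖ ^ 2 :=
            mul_le_mul_of_nonneg_right h1 h3.le
        _ = B v v := by field_simp

end TwistBilin

section Metric

variable {E : Type*} [NormedAddCommGroup E] [NormedSpace ℂ E]
  {M : Type*} [TopologicalSpace M] [ChartedSpace E M]
  [FiniteDimensional ℂ E] [IsManifold 𝓘(ℂ, E) ω M] [IsManifold 𝓘(ℝ, E) ∞ M]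

/-- **A closed, smooth, positive real `(1,1)`-form is the Kähler form of a Kähler metric.** Let
`θ` be a smooth closed real `2`-form on the complex manifold `M` which is `J`-invariant
(`θ(Jv, Jw) = θ(v, w)`, i.e. of type `(1,1)`) and positive (`θ(v, Jv) > 0` for `v ≠ 0`). Then
`g(v, w) := θ(v, Jw)` is a smooth Riemannian metric on the real tangent bundle which is Hermitian
with Kähler form `θ`, so `M` is a Kähler manifold (Voisin (2002), §3.1.1, Lemma 3.3 and the
lines after (3.1): the `J`-invariant symmetric forms `g` correspond to the real `(1,1)`-forms `ω`
by `g(u, v) = ω(u, Iv)`, `ω(u, v) = g(Iu, v)`; §3.1.2 Def. 3.6: Kähler = `dω = 0`). Smoothness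
of `g` as a section of Mathlib's bundle of bilinear forms is read off in the trivialization at
`x₀`, which conjugates by the inverse tangent trivialization (`trivializationAt_bilinForm_apply₂`)
— a `ℂ`-linear map (`symmL_trivializationAt_I_smul`) equal to the derivative of the inverse chart
(`TangentBundle.symmL_trivializationAt`) — so that the coordinate expression of `g` is
`twistBilin ∘ (θ.inChart x₀)`, a `C^∞` function of the chart representative of `θ`.
[cite: VoisinHodgeI2002, §3.1.1 Lemma 3.3, §3.1.2 Def. 3.6] -/
theorem isKaehlerManifold_of_closed_positive_form (θ : MForm 𝓘(ℝ, E) M ℝ 2)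
    (hs : IsSmoothForm θ) (hc : IsClosedForm θ)
    (hJ : ∀ (x : M) (v w : TangentSpace 𝓘(ℝ, E) x),
      θ x ![tangentJ E x v, tangentJ E x w] = θ x ![v, w])
    (hp : ∀ (x : M) (v : TangentSpace 𝓘(ℝ, E) x), v ≠ 0 → 0 < θ x ![v, tangentJ E x v]) :
    IsKaehlerManifold E M := by
  -- the coefficient forms `g₀ x (v, w) = θ x (v, Jw)`, built on the model fibre `E`
  let g₀ : ∀ x : M, TangentSpace 𝓘(ℝ, E) x →L[ℝ] TangentSpace 𝓘(ℝ, E) x →L[ℝ] ℝ :=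
    fun x ↦ (twistBilin (E := E) (θ x :) :)
  have hg₀ : ∀ (x : M) (v w : TangentSpace 𝓘(ℝ, E) x), g₀ x v w = θ x ![v, tangentJ E x w] :=
    fun x v w ↦ rfl
  -- symmetry, from `J`-invariance and antisymmetry
  have hsymm : ∀ (x : M) (v w : TangentSpace 𝓘(ℝ, E) x), g₀ x v w = g₀ x w v := by
    intro x v w
    rw [hg₀, hg₀, ← hJ x w (tangentJ E x v), tangentJ_tangentJ, cam₂_neg_right,
      cam₂_swap (θ x) (tangentJ E x w) v, neg_neg]
  -- smoothness, in the trivialization at `x₀`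
  have hsmooth : ∀ x₀ : M, ContMDiffAt 𝓘(ℝ, E) (𝓘(ℝ, E).prod 𝓘(ℝ, E →L[ℝ] E →L[ℝ] ℝ)) ∞
      (fun x ↦ TotalSpace.mk' (E →L[ℝ] E →L[ℝ] ℝ) x (g₀ x)) x₀ := by
    intro x₀
    rw [contMDiffAt_section, contMDiffAt_iff_source, contMDiffWithinAt_iff_contDiffWithinAt]
    -- on the chart target, the coordinate expression of `g₀` is `twistBilin ∘ θ.inChart x₀`
    have hev : ∀ y ∈ (extChartAt 𝓘(ℝ, E) x₀).target,
        ((fun x ↦ (trivializationAt (E →L[ℝ] E →L[ℝ] ℝ)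
          (fun x : M ↦ TangentSpace 𝓘(ℝ, E) x →L[ℝ] TangentSpace 𝓘(ℝ, E) x →L[ℝ] ℝ) x₀
            ⟨x, g₀ x⟩).2) ∘ (extChartAt 𝓘(ℝ, E) x₀).symm) y = twistBilin (θ.inChart x₀ y) := by
      intro y hy
      have hx : (extChartAt 𝓘(ℝ, E) x₀).symm y ∈ (chartAt E x₀).source := by
        rw [← extChartAt_source 𝓘(ℝ, E)]
        exact (extChartAt 𝓘(ℝ, E) x₀).map_target hy
      have hD : mfderivWithin 𝓘(ℝ, E) 𝓘(ℝ, E) (extChartAt 𝓘(ℝ, E) x₀).symm (range 𝓘(ℝ, E)) y =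
          (trivializationAt E (TangentSpace 𝓘(ℝ, E)) x₀).symmL ℝ
            ((extChartAt 𝓘(ℝ, E) x₀).symm y) := by
        rw [TangentBundle.symmL_trivializationAt hx, (extChartAt 𝓘(ℝ, E) x₀).right_inv hy]
      ext v w
      simp only [Function.comp_apply, twistBilin_apply]
      rw [trivializationAt_bilinForm_apply₂, hg₀, ← symmL_trivializationAt_I_smul hx,
        MForm.inChart_apply, hD]
      congr 1
      funext i
      fin_cases i <;> rfl
    refine ((contDiff_twistBilin (E := E)).contDiffAt.comp_contDiffWithinAt _
      (hs x₀)).congr_of_eventuallyEq ?_ (hev _ (mem_extChartAt_target x₀))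
    exact Filter.eventuallyEq_of_mem (extChartAt_target_mem_nhdsWithin x₀) hev
  -- the metric
  let g : ContMDiffRiemannianMetric 𝓘(ℝ, E) ∞ E (fun x : M ↦ TangentSpace 𝓘(ℝ, E) x) :=
    { inner := g₀
      symm := hsymm
      pos := fun x v hv ↦ hp x v hv
      isVonNBounded := fun x ↦ by
        change Bornology.IsVonNBounded ℝ {v : E | twistBilin (E := E) (θ x :) v v < 1}
        obtain ⟨c, hc0, hcv⟩ := exists_pos_mul_norm_sq_le (V := E) (twistBilin (E := E) (θ x :))
          (fun v hv ↦ hp x v hv)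
        refine (NormedSpace.isVonNBounded_ball ℝ E (c⁻¹ + 1)).subset ?_
        intro v hv
        rw [Set.mem_setOf_eq] at hv
        rw [Metric.mem_ball, dist_zero_right]
        have h1 : c * ‖v‖ ^ 2 < 1 := (hcv v).trans_lt hv
        have h2 : ‖v‖ ^ 2 < c⁻¹ := by
          have := mul_lt_mul_of_pos_left h1 (inv_pos.2 hc0)
          rwa [← mul_assoc, inv_mul_cancel₀ hc0.ne', one_mul, mul_one] at this
        by_cases h3 : ‖v‖ ≤ 1
        · have : (0 : ℝ) < c⁻¹ := inv_pos.2 hc0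
          linarith
        · push Not at h3
          nlinarith [norm_nonneg v]
      contMDiff := hsmooth }
  -- Hermitian, with Kähler form `θ`
  have hHerm : g.toRiemannianMetric.IsHermitian := by
    intro x v w
    change g₀ x (tangentJ E x v) (tangentJ E x w) = g₀ x v w
    rw [hg₀, hg₀]
    exact hJ x v (tangentJ E x w)
  have hform : g.toRiemannianMetric.kaehlerForm = θ := by
    funext x
    ext u
    rw [eq_vecCons_two u, Bundle.RiemannianMetric.kaehlerForm_apply_of_isHermitian _ hHerm]
    change g₀ x (tangentJ E x (u 0)) (u 1) = θ x ![u 0, u 1]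
    rw [hg₀]
    exact hJ x (u 0) (u 1)
  exact ⟨⟨g, hHerm, by rw [hform]; exact hc⟩⟩

end Metric

end Literature.Geometry.Kaehler
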